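import Summits.ValiantsHypothesis.ValiantsHypothesis.Theorems.DivisionGapPerDivisionHardStubKeyPlacement
import Summits.ValiantsHypothesis.ValiantsHypothesis.Theorems.DivisionGapPerDivisionHardStubGenericCut
import Summits.ValiantsHypothesis.ValiantsHypothesis.Theorems.DivisionGapPerDivisionHardStubBlockFits

/-!
# Crux `DivisionGap.PerDivisionHard` (stmt-ValiantsHypothesis-5065), line `pair-descent-jss-endpoint` —
stub `stub_keyRigid` (skeleton v15.1, the lead's stub): K2 for cofactors with a small KEY

A cell set `K` is a KEY for `h` if two monomials of `h` that agree on `K` are equal.  If a nonzero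
torus-homogeneous `h ∈ ℝ≥0[x_ij]` has a key `K` with `4|K| ≤ n`, then the placement of the block
arsenal `G(b,1) ⊕ M₀` whose face AVOIDS `K` (`stub_keyPlacement`, `b = (log₂ n + d)^d`) and the
generic cut (`stub_genericCut`) have a top fibre with a single `G`-part — in fact one monomial: two
fibre monomials agree off the face, hence on `K`, hence everywhere.  Room: `2|K| + 2(b + b²) ≤ n`
from `4|K| ≤ n` and `4(b + b²) ≤ b + 8b² ≤ n` (`stub_blockFits` with `k = 8`).
-/

noncomputable section

-- `Summit.ValiantsHypothesis.ValiantsHypothesis.…` is the tree's mandated single-conjunct layout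
-- (Sub = Summit), so the duplicated namespace component is intended.
set_option linter.dupNamespace false

namespace Summit.ValiantsHypothesis.ValiantsHypothesis.Theorems.DivisionGapPerDivisionHard

open MvPolynomial Literature.Computability.AlgebraicComplexity
open Summit.ValiantsHypothesis.ValiantsHypothesis.Theorems.ZeroOneTransfer.Negative
  (topComponent support_topComponent_subset topComponent_ne_zero)
open scoped NNReal

/-- Polylog bookkeeping: `4(b + b²) ≤ b + 8b²` for every natural `b`. [folklore] -/
theorem four_mul_block_le (b : ℕ) : 4 * (b + b * (b * 1)) ≤ b + b * (b * 8) := by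
  rcases Nat.eq_zero_or_pos b with rfl | hb
  · simp
  · have h3 : 3 * b ≤ 4 * (b * b) :=
      calc 3 * b ≤ 4 * (b * 1) := by omega
        _ ≤ 4 * (b * b) := Nat.mul_le_mul_left 4 (Nat.mul_le_mul_left b hb)
    have e1 : 4 * (b + b * (b * 1)) = 4 * b + 4 * (b * b) := by ring
    have e2 : b + b * (b * 8) = b + 8 * (b * b) := by ring
    rw [e1, e2]
    omega

/-- **`stub_keyRigid` (K2 of line `pair-descent-jss-endpoint` for cofactors with a small KEY;
skeleton v15.1, the lead's stub).**  For every `d` there is `n₀` such that for `n ≥ n₀`: if the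
monomials of a nonzero torus-homogeneous `h` are determined by their exponents on a cell set `K`
with `4|K| ≤ n`, then some placement `eR eC` of `G(b,1) ⊕ M₀` with `b = (log₂ n + d)^d` (its face off
`K`, `stub_keyPlacement`), the generic cut `w` (`stub_genericCut`) and some `u` satisfy
`CutsOut w (placedBlock eR eC)` and `HasSingleGPart (placedBlock eR eC) w h u`. [folklore] -/
theorem stub_keyRigid :
    ∀ d : ℕ, ∃ n₀ : ℕ, ∀ n ≥ n₀, ∀ h : MvPolynomial (Fin n × Fin n) ℝ≥0,
      h ≠ 0 → IsTorusHomogeneous h → ∀ K : Finset (Fin n × Fin n), 4 * K.card ≤ n →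
      (∀ m₁ ∈ h.support, ∀ m₂ ∈ h.support, (∀ e ∈ K, m₁ e = m₂ e) → m₁ = m₂) →
      ∃ (b k m : ℕ) (eR eC : BlockV b k m ≃ Fin n) (w : Fin n × Fin n → ℕ)
        (u : (Fin n × Fin n) →₀ ℕ),
        (Nat.log 2 n + d) ^ d ≤ b ∧ CutsOut w (placedBlock eR eC) ∧
          HasSingleGPart (placedBlock eR eC) w h u := by
  intro d
  obtain ⟨n₀, hfit⟩ := stub_blockFits d
  refine ⟨n₀ + 64, fun n hn h hh htor K hK hkey => ?_⟩
  classical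
  set b := (Nat.log 2 n + d) ^ d with hb
  -- room for the placement: `2|K| + 2(b + b²) ≤ n`
  have h8 : b + b * (b * 8) ≤ n := hfit n (by omega) 8 (by omega)
  have hN : 4 * (b + b * (b * 1)) ≤ n := le_trans (four_mul_block_le b) h8
  have hroom : 2 * K.card + 2 * (b + b * (b * 1)) ≤ n := by omega
  obtain ⟨eR, eC, havoid⟩ := stub_keyPlacement b n K hroom
  set G := placedBlock eR eC with hG
  -- the generic cut: all monomials of `h` have the same degree
  have hdeg : ∀ p₁ ∈ h.support, ∀ p₂ ∈ h.support, p₁.degree = p₂.degree := by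
    intro p₁ hp₁ p₂ hp₂
    obtain ⟨r₀, c₀, hrc⟩ := htor
    exact degree_eq_of_rowDegrees_eq ((hrc p₁ hp₁).1.trans (hrc p₂ hp₂).1.symm)
  obtain ⟨w, hcut, hagree⟩ :=
    stub_genericCut b 1 (n - (b + b * (b * 1))) n eR eC h Nat.one_pos hdeg
  -- its top fibre is a single monomial: two fibre monomials agree off `G ⊇ ∅`, hence on `K`
  have hfib : ∀ m₁ ∈ (topComponent w h).support, ∀ m₂ ∈ (topComponent w h).support,
      m₁ = m₂ := by
    intro m₁ hm₁ m₂ hm₂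
    refine hkey m₁ (support_topComponent_subset _ h hm₁) m₂ (support_topComponent_subset _ h hm₂)
      fun e he => hagree m₁ hm₁ m₂ hm₂ e fun heG => havoid e heG he
  -- conclusion: `u` is the `G`-part of the unique monomial of the top fibre
  obtain ⟨m₀, hm₀⟩ := support_nonempty.mpr (topComponent_ne_zero w hh)
  refine ⟨b, 1, n - (b + b * (b * 1)), eR, eC, w, m₀.filter (· ∈ G), le_rfl, hcut,
    fun e he => ?_, fun m' hm' e he => ?_⟩
  · rw [Finsupp.support_filter] at he
    exact (Finset.mem_filter.mp he).2
  · rw [hfib m' hm' m₀ hm₀, Finsupp.filter_apply_pos _ _ he]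

end Summit.ValiantsHypothesis.ValiantsHypothesis.Theorems.DivisionGapPerDivisionHard

end
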